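import Literature.MathematicalPhysics.KineticTheory.VelocityFlipSteadyStateExists
import HarnessLib

/-!
# Stub `stub_flipNessExists` of line `sector-dirichlet-gluing`
(crux `VanishingNoiseTransfer.NoisyFourier`, item stmt-AtomisticToContinuum-11977)

Clause (i) of the flip Fourier law, EXISTENCE half: for the pinned anharmonic chain
`pinnedChain ω₂ lam β γ` (`ω₂, lam, β, γ > 0`) with velocity flips at rate `ε > 0` at every site,
a weak flip steady state (`OscillatorChain.IsFlipSteadyState`: probability measure,
`∫ (L f + ε S f) dμ = 0` for all `f ∈ C_c^∞`, integrable bond currents) exists for every `N` and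
all bath temperatures `T_L, T_R > 0`. This is the Literature theorem
`pinnedChain_exists_isFlipSteadyState` (`VelocityFlipSteadyStateExists.lean`: the chain embedded at
the flip times, `K = Q ∘ₖ R_{Nε}` with the resolvent kernel of the flip-free transition semigroup
and the uniform site flip `Q`, discrete Krylov–Bogoliubov with the Lyapunov function `e^{θH}`,
`μ = π R_{Nε}`; `N = 0` Dirac, `N = 1` Gibbs at the mean temperature), restated verbatim in the
registered stub shape of the skeleton `NoisyFourier_of`, where it is paired with
`stub_flipNessUnique` into clause (i) `∃!`.
-/

namespace Summit.AtomisticToContinuum.FouriersLaw.Cruxes.NoisyFourier.SectorDirichletGluing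

open Literature.MathematicalPhysics.KineticTheory.HeatConduction

/-- **Stub 1a of line `sector-dirichlet-gluing` — clause (i), existence half.** For all
`ω₂, lam, β, γ > 0`, every flip rate `ε > 0`, every `N` and all `T_L, T_R > 0`, the pinned
anharmonic chain with velocity flips has a weak flip steady state. Witness:
`pinnedChain_exists_isFlipSteadyState` (Bernardin–Olla 2011, Prop. 1, existence half, proved in
the tree by the embedded chain at the flip times + discrete Krylov–Bogoliubov). [folklore] -/
theorem stub_flipNessExists :
    ∀ ω₂ lam β γ : ℝ, 0 < ω₂ → 0 < lam → 0 < β → 0 < γ → ∀ ε : ℝ, 0 < ε →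
      ∀ (N : ℕ) (T_L T_R : ℝ), 0 < T_L → 0 < T_R →
        ∃ μ : MeasureTheory.Measure
            (Literature.MathematicalPhysics.KineticTheory.HeatConduction.PhaseSpace N),
          (Literature.MathematicalPhysics.KineticTheory.HeatConduction.pinnedChain
              ω₂ lam β γ).IsFlipSteadyState N T_L T_R ε μ :=
  fun _ω₂ _lam _β _γ hω hl hβ hγ _ε hε N _T_L _T_R hL hR =>
    pinnedChain_exists_isFlipSteadyState hω hl hβ hγ hε N hL hR

end Summit.AtomisticToContinuum.FouriersLaw.Cruxes.NoisyFourier.SectorDirichletGluing
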